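import Summits.Ventures.PercRepro2.CaseOneMoves
import Summits.Ventures.PercRepro2.CaseOneResidual
import Summits.Ventures.PercRepro2.CaseOneMarkMoves

/-!
# The reduction calculus of the rung, marks included: every instance reduces to an irreducible one
(blind cell PercRepro2, p1 g29; `CaseOneResidual` with the pendant step and the mark moves added)

An INSTANCE of the rung is a marking `(o, a₁, a₂, a₃, b)` on an edge-labelled graph `(E, ends)`. One
REDUCTION STEP (`RedStep`, from the instance to a smaller one) is: a thickening step read downward
(an unmarked leaf deleted, a parallel pair merged, an unmarked series vertex suppressed, a loop
deleted — `ThickStep`); the PENDANT STEP (an unmarked statement vertex that is a leaf at `x` is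
replaced by `x`, K8); the MARK MOVES (a pendant `o` or `b` is replaced by its neighbour,
CaseOneMarkMoves). Every step deletes one edge (`RedStep.card_lt`) and preserves the closed property
upward (`closedAt_of_redStep`, `closedAt_of_reduces`), so by strong induction on the number of edges
**every instance reduces to an IRREDUCIBLE instance** (`exists_irreducible_reduces`) and
**`closedAt_of_irreducible`**: if every irreducible instance is closed, every instance is. An
irreducible instance has no unmarked leaf, no parallel pair, no unmarked series vertex, no loop, an
unmarked statement vertex of degree `≠ 1`, and neither `o` nor `b` a leaf (unless it coincides with
another mark) — the residual class of record of S5 §2.3, in the kernel. Own code; standard axioms.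
-/

namespace Summit.Ventures.PercRepro2

namespace CaseOne

universe u

section Red
variable {V : Type*}

/-- **One reduction step** of the rung, from an instance to a smaller one: a thickening step read
downward, the pendant step of the statement vertex, or a mark move. -/
inductive RedStep :
    (o a₁ a₂ a₃ b : V) → (E : Type u) → [Fintype E] → [DecidableEq E] → (E → Sym2 V) →
      (o' a₁' a₂' a₃' b' : V) → (E' : Type u) → [Fintype E'] → [DecidableEq E'] → (E' → Sym2 V) →
        Prop
  /-- a thickening step, read downward (the marks fixed) -/
  | thick {o a₁ a₂ a₃ b : V} {E : Type u} [Fintype E] [DecidableEq E] {ends : E → Sym2 V}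
      {E' : Type u} [Fintype E'] [DecidableEq E'] {ends' : E' → Sym2 V}
      (h : ThickStep o a₁ a₂ b a₃ E' ends' E ends) :
      RedStep o a₁ a₂ a₃ b E ends o a₁ a₂ a₃ b E' ends'
  /-- the pendant step: an unmarked statement vertex that is a leaf at `x` is replaced by `x` -/
  | leafMove {o a₁ a₂ b : V} (E : Type u) [Fintype E] [DecidableEq E] (ends : E → Sym2 V) (x a₃ : V)
      (e₀ : E) (hl : IsLeafAt ends x a₃ e₀) (ho : o ≠ a₃) (h1 : a₁ ≠ a₃) (h2 : a₂ ≠ a₃)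
      (hb : b ≠ a₃) :
      RedStep o a₁ a₂ a₃ b E ends o a₁ a₂ x b {e : E // e ≠ e₀} (restrictEnds ends e₀)
  /-- the mark move: a pendant `o` at `y` is replaced by `y` -/
  | oMove {a₁ a₂ a₃ b : V} (E : Type u) [Fintype E] [DecidableEq E] (ends : E → Sym2 V) (y o : V)
      (e₀ : E) (hl : IsLeafAt ends y o e₀) (h1 : a₁ ≠ o) (h2 : a₂ ≠ o) (h3 : a₃ ≠ o) (hb : b ≠ o) :
      RedStep o a₁ a₂ a₃ b E ends y a₁ a₂ a₃ b {e : E // e ≠ e₀} (restrictEnds ends e₀)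
  /-- the mark move: a pendant `b` at `y` is replaced by `y` -/
  | bMove {o a₁ a₂ a₃ : V} (E : Type u) [Fintype E] [DecidableEq E] (ends : E → Sym2 V) (y b : V)
      (e₀ : E) (hl : IsLeafAt ends y b e₀) (ho : o ≠ b) (h1 : a₁ ≠ b) (h2 : a₂ ≠ b) (h3 : a₃ ≠ b) :
      RedStep o a₁ a₂ a₃ b E ends o a₁ a₂ a₃ y {e : E // e ≠ e₀} (restrictEnds ends e₀)

/-- **Reductions**: finitely many reduction steps (an inductive family; the marks, the edge type and
the statement vertex change along the way). -/
inductive Reduces :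
    (o a₁ a₂ a₃ b : V) → (E : Type u) → [Fintype E] → [DecidableEq E] → (E → Sym2 V) →
      (o' a₁' a₂' a₃' b' : V) → (E' : Type u) → [Fintype E'] → [DecidableEq E'] → (E' → Sym2 V) →
        Prop
  /-- no step -/
  | refl (o a₁ a₂ a₃ b : V) (E : Type u) [Fintype E] [DecidableEq E] (ends : E → Sym2 V) :
      Reduces o a₁ a₂ a₃ b E ends o a₁ a₂ a₃ b E ends
  /-- one more step after a reduction -/
  | tail {o a₁ a₂ a₃ b : V} {E : Type u} [Fintype E] [DecidableEq E] {ends : E → Sym2 V}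
      {om a₁m a₂m a₃m bm : V} {Em : Type u} [Fintype Em] [DecidableEq Em] {endsm : Em → Sym2 V}
      {o' a₁' a₂' a₃' b' : V} {E' : Type u} [Fintype E'] [DecidableEq E'] {ends' : E' → Sym2 V}
      (h : Reduces o a₁ a₂ a₃ b E ends om a₁m a₂m a₃m bm Em endsm)
      (hstep : RedStep om a₁m a₂m a₃m bm Em endsm o' a₁' a₂' a₃' b' E' ends') :
      Reduces o a₁ a₂ a₃ b E ends o' a₁' a₂' a₃' b' E' ends'

/-- A reduction step deletes one edge. -/
theorem RedStep.card_lt {o a₁ a₂ a₃ b : V} {E : Type u} [Fintype E] [DecidableEq E]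
    {ends : E → Sym2 V} {o' a₁' a₂' a₃' b' : V} {E' : Type u} [Fintype E'] [DecidableEq E']
    {ends' : E' → Sym2 V} (h : RedStep o a₁ a₂ a₃ b E ends o' a₁' a₂' a₃' b' E' ends') :
    Fintype.card E' < Fintype.card E := by
  cases h with
  | thick h => exact h.card_lt
  | leafMove E ends x a₃ e₀ hl ho h1 h2 hb => exact Fintype.card_subtype_lt (x := e₀) (by simp)
  | oMove E ends y o e₀ hl h1 h2 h3 hb => exact Fintype.card_subtype_lt (x := e₀) (by simp)
  | bMove E ends y b e₀ hl ho h1 h2 h3 => exact Fintype.card_subtype_lt (x := e₀) (by simp)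

variable {R : Type*} [CommRing R] [LinearOrder R] [IsStrictOrderedRing R]

/-- **One reduction step preserves the closed property upward.** -/
theorem closedAt_of_redStep {o a₁ a₂ a₃ b : V} {E : Type u} [Fintype E] [DecidableEq E]
    {ends : E → Sym2 V} {o' a₁' a₂' a₃' b' : V} {E' : Type u} [Fintype E'] [DecidableEq E']
    {ends' : E' → Sym2 V} (h : RedStep o a₁ a₂ a₃ b E ends o' a₁' a₂' a₃' b' E' ends')
    (hc : ClosedAt R o' a₁' a₂' b' E' ends' a₃') : ClosedAt R o a₁ a₂ b E ends a₃ := by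
  cases h with
  | thick h => exact closedAt_of_thickStep h hc
  | leafMove E ends x a₃ e₀ hl ho h1 h2 hb =>
    exact closedAt_of_moveStep (MoveStep.leafMove _ _ _ _ _ hl ho h1 h2 hb) hc
  | oMove E ends y o e₀ hl h1 h2 h3 hb => exact closedAt_of_o_move hl h1 h2 h3 hb hc
  | bMove E ends y b e₀ hl ho h1 h2 h3 => exact closedAt_of_b_move hl ho h1 h2 h3 hc

/-- **The closed property is preserved upward along every reduction.** -/
theorem closedAt_of_reduces {o a₁ a₂ a₃ b : V} {E : Type u} [Fintype E] [DecidableEq E]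
    {ends : E → Sym2 V} {o' a₁' a₂' a₃' b' : V} {E' : Type u} [Fintype E'] [DecidableEq E']
    {ends' : E' → Sym2 V} (h : Reduces o a₁ a₂ a₃ b E ends o' a₁' a₂' a₃' b' E' ends')
    (hc : ClosedAt R o' a₁' a₂' b' E' ends' a₃') : ClosedAt R o a₁ a₂ b E ends a₃ := by
  induction h with
  | refl => exact hc
  | tail _ hstep ih => exact ih (closedAt_of_redStep hstep hc)

/-- **Irreducible**: no reduction step applies — no unmarked leaf, no parallel pair, no unmarked
series vertex, no loop, the statement vertex not an unmarked leaf, neither `o` nor `b` a leaf (unless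
coincident with another mark). -/
def Irreducible (o a₁ a₂ a₃ b : V) (E : Type u) [Fintype E] [DecidableEq E] (ends : E → Sym2 V) :
    Prop :=
  ¬ ∃ (o' a₁' a₂' a₃' b' : V) (E' : Type u) (_ : Fintype E') (_ : DecidableEq E')
    (ends' : E' → Sym2 V), RedStep o a₁ a₂ a₃ b E ends o' a₁' a₂' a₃' b' E' ends'

/-- A reduction step followed by a reduction is a reduction. -/
theorem Reduces.head {o a₁ a₂ a₃ b : V} {E : Type u} [Fintype E] [DecidableEq E] {ends : E → Sym2 V}
    {om a₁m a₂m a₃m bm : V} {Em : Type u} [Fintype Em] [DecidableEq Em] {endsm : Em → Sym2 V}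
    {o' a₁' a₂' a₃' b' : V} {E' : Type u} [Fintype E'] [DecidableEq E'] {ends' : E' → Sym2 V}
    (hstep : RedStep o a₁ a₂ a₃ b E ends om a₁m a₂m a₃m bm Em endsm)
    (h : Reduces om a₁m a₂m a₃m bm Em endsm o' a₁' a₂' a₃' b' E' ends') :
    Reduces o a₁ a₂ a₃ b E ends o' a₁' a₂' a₃' b' E' ends' := by
  induction h with
  | refl => exact Reduces.tail (Reduces.refl o a₁ a₂ a₃ b E ends) hstep
  | tail _ hstep' ih => exact Reduces.tail ih hstep'

/-- **Every instance reduces to an irreducible instance**: strong induction on the number of edges,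
one reduction step at a time. -/
theorem exists_irreducible_reduces :
    ∀ (n : ℕ) (o a₁ a₂ a₃ b : V) (E : Type u) [Fintype E] [DecidableEq E] (ends : E → Sym2 V),
      Fintype.card E = n →
      ∃ (o' a₁' a₂' a₃' b' : V) (E' : Type u) (_ : Fintype E') (_ : DecidableEq E')
        (ends' : E' → Sym2 V), Irreducible o' a₁' a₂' a₃' b' E' ends' ∧
          Reduces o a₁ a₂ a₃ b E ends o' a₁' a₂' a₃' b' E' ends' := by
  intro n
  induction n using Nat.strong_induction_on with
  | _ n ih =>
    intro o a₁ a₂ a₃ b E _ _ ends hn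
    by_cases hred : ∃ (o' a₁' a₂' a₃' b' : V) (E' : Type u) (_ : Fintype E') (_ : DecidableEq E')
        (ends' : E' → Sym2 V), RedStep o a₁ a₂ a₃ b E ends o' a₁' a₂' a₃' b' E' ends'
    · obtain ⟨om, a₁m, a₂m, a₃m, bm, Em, _, _, endsm, hstep⟩ := hred
      have hlt : Fintype.card Em < n := hn ▸ hstep.card_lt
      obtain ⟨o', a₁', a₂', a₃', b', E', _, _, ends', hirr, hred'⟩ :=
        ih _ hlt om a₁m a₂m a₃m bm Em endsm rfl
      exact ⟨o', a₁', a₂', a₃', b', E', _, _, ends', hirr, Reduces.head hstep hred'⟩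
    · exact ⟨o, a₁, a₂, a₃, b, E, _, _, ends, hred, Reduces.refl o a₁ a₂ a₃ b E ends⟩

/-- **The reduction to the irreducible class**: if every irreducible instance is closed, every
instance is closed. -/
theorem closedAt_of_irreducible
    (hirr : ∀ (o a₁ a₂ a₃ b : V) (E : Type u) [Fintype E] [DecidableEq E] (ends : E → Sym2 V),
      Irreducible o a₁ a₂ a₃ b E ends → ClosedAt R o a₁ a₂ b E ends a₃)
    (o a₁ a₂ a₃ b : V) (E : Type u) [Fintype E] [DecidableEq E] (ends : E → Sym2 V) :
    ClosedAt R o a₁ a₂ b E ends a₃ := by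
  obtain ⟨o', a₁', a₂', a₃', b', E', _, _, ends', hi, hr⟩ :=
    exists_irreducible_reduces (Fintype.card E) o a₁ a₂ a₃ b E ends rfl
  exact closedAt_of_reduces hr (hirr o' a₁' a₂' a₃' b' E' ends' hi)

/-- The four forms for one weight vector on any instance, from the irreducible class. -/
theorem fourForms_of_irreducible
    (hirr : ∀ (o a₁ a₂ a₃ b : V) (E : Type u) [Fintype E] [DecidableEq E] (ends : E → Sym2 V),
      Irreducible o a₁ a₂ a₃ b E ends → ClosedAt R o a₁ a₂ b E ends a₃)
    (o a₁ a₂ a₃ b : V) {E : Type u} [Fintype E] [DecidableEq E] (ends : E → Sym2 V) (p : E → R)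
    (hp : IsProbVec p) : FourForms p ends o a₁ a₂ a₃ b :=
  closedAt_of_irreducible hirr o a₁ a₂ a₃ b E ends p hp

end Red

end CaseOne

end Summit.Ventures.PercRepro2
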